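import Mathlib.Analysis.SpecialFunctions.PolarCoord
import Mathlib.MeasureTheory.Integral.IntegralEqImproper
import Mathlib.Analysis.InnerProductSpace.PiL2
import Mathlib.MeasureTheory.Measure.Haar.InnerProductSpace
import HarnessLib

/-!
# The flux integral `∫ (x·∇ψ)/|x|² dx = −2π ψ(0)` on the plane

For a `C¹` function `ψ` with compact support on `ℝ²`,

  `∫_{ℝ²} (x ∂₁ψ + y ∂₂ψ)/(x² + y²) dx dy = −2π ψ(0)`

(`integral_radialDeriv_div_normSq`): in polar coordinates the integrand times the Jacobian `r`
is `∂_r [ψ(r cos θ, r sin θ)]`, whose integral over `r ∈ (0, ∞)` is `−ψ(0)` for every `θ`. This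
is the index computation `∮ dθ = 2π` around an isolated zero of index `±1` of a planar vector
field in the form used by the intrinsic proof of the Gauss–Bonnet theorem (the boundary term of
`K dA = dω₁₂` at a singularity of the frame; Chern 1944, §2), written as a bulk integral against a
cutoff so that no Stokes theorem on a punctured disc is needed. `integral_radialDeriv_div_normSq_euclidean`
is the same statement on `EuclideanSpace ℝ (Fin 2)`. Everything is proved; no definitions.

## References

* S.-S. Chern, *A simple intrinsic proof of the Gauss–Bonnet formula for closed Riemannian
  manifolds*, Ann. of Math. 45 (1944), §2 (the index of the singularities of the frame).
  [Chern1944]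
-/

noncomputable section

open Set Filter MeasureTheory MeasureTheory.Measure Real
open scoped Topology Real

namespace Literature.Analysis.Calculus

/-- The derivative of a function vanishes off its topological support. [folklore] -/
theorem fderiv_eq_zero_of_notMem_tsupport' {E F : Type*} [NormedAddCommGroup E] [NormedSpace ℝ E]
    [NormedAddCommGroup F] [NormedSpace ℝ F] {f : E → F} {x : E} (hx : x ∉ tsupport f) :
    fderiv ℝ f x = 0 := by
  have hev : f =ᶠ[𝓝 x] fun _ ↦ 0 := by
    filter_upwards [(isClosed_tsupport f).isOpen_compl.mem_nhds hx] with z hz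
    exact image_eq_zero_of_notMem_tsupport hz
  rw [hev.fderiv_eq, fderiv_fun_const]
  rfl

/-- **`∫_{ℝ²} (x·∇ψ)/|x|² = −2π ψ(0)`** for `ψ ∈ C¹_c(ℝ²)`: in polar coordinates
(`integral_comp_polarCoord_symm`) the integrand times `r` is the radial derivative
`∂_r[ψ(r cos θ, r sin θ)]`, and `∫_{(0,∞)} ∂_r[ψ(r cos θ, r sin θ)] dr = −ψ(0)`
(`HasCompactSupport.integral_Ioi_deriv_eq`) for each `θ ∈ (−π, π)`. [cite: Chern1944, §2] -/
theorem integral_radialDeriv_div_normSq {ψ : ℝ × ℝ → ℝ} (hψ : ContDiff ℝ 1 ψ)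
    (hs : HasCompactSupport ψ) :
    ∫ q : ℝ × ℝ, (q.1 * fderiv ℝ ψ q (1, 0) + q.2 * fderiv ℝ ψ q (0, 1)) / (q.1 ^ 2 + q.2 ^ 2) =
      -(2 * π * ψ 0) := by
  -- a radius beyond the support
  obtain ⟨R, hRpos, hR⟩ : ∃ R : ℝ, 0 < R ∧ ∀ q ∈ tsupport ψ, q.1 ^ 2 + q.2 ^ 2 < R ^ 2 := by
    obtain ⟨C, hC⟩ := hs.isCompact.isBounded.subset_closedBall (0 : ℝ × ℝ)
    refine ⟨2 * (|C| + 1), by positivity, fun q hq ↦ ?_⟩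
    have hq' : ‖q‖ ≤ C := by simpa using hC hq
    have h1 : |q.1| ≤ |C| := (norm_fst_le q).trans (hq'.trans (le_abs_self C))
    have h2 : |q.2| ≤ |C| := (norm_snd_le q).trans (hq'.trans (le_abs_self C))
    have h1' : q.1 ^ 2 ≤ |C| ^ 2 := by simpa only [sq_abs] using pow_le_pow_left₀ (abs_nonneg _) h1 2
    have h2' : q.2 ^ 2 ≤ |C| ^ 2 := by simpa only [sq_abs] using pow_le_pow_left₀ (abs_nonneg _) h2 2
    nlinarith [abs_nonneg C]
  have hzero : ∀ q : ℝ × ℝ, R ^ 2 ≤ q.1 ^ 2 + q.2 ^ 2 → fderiv ℝ ψ q = 0 := fun q hq ↦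
    fderiv_eq_zero_of_notMem_tsupport' fun h ↦ (not_lt.2 hq) (hR q h)
  have hzero' : ∀ q : ℝ × ℝ, R ^ 2 ≤ q.1 ^ 2 + q.2 ^ 2 → ψ q = 0 := fun q hq ↦
    image_eq_zero_of_notMem_tsupport fun h ↦ (not_lt.2 hq) (hR q h)
  -- the radial functions `g θ r = ψ(r cos θ, r sin θ)` and their derivatives
  set g : ℝ → ℝ → ℝ := fun θ r ↦ ψ (r * cos θ, r * sin θ) with hg
  set D : ℝ → ℝ → ℝ := fun θ r ↦ cos θ * fderiv ℝ ψ (r * cos θ, r * sin θ) (1, 0) +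
    sin θ * fderiv ℝ ψ (r * cos θ, r * sin θ) (0, 1) with hD
  have hcurve : ∀ θ r, HasDerivAt (fun r : ℝ ↦ ((r * cos θ, r * sin θ) : ℝ × ℝ)) (cos θ, sin θ) r := by
    intro θ r
    refine HasDerivAt.prodMk ?_ ?_
    · simpa using (hasDerivAt_id r).mul_const (cos θ)
    · simpa using (hasDerivAt_id r).mul_const (sin θ)
  have hψd : Differentiable ℝ ψ := hψ.differentiable one_ne_zero
  have hderiv : ∀ θ r, HasDerivAt (g θ) (D θ r) r := by
    intro θ r
    have h := (hψd (r * cos θ, r * sin θ)).hasFDerivAt.comp_hasDerivAt r (hcurve θ r)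
    have hlin : fderiv ℝ ψ (r * cos θ, r * sin θ) (cos θ, sin θ) = D θ r := by
      have : ((cos θ, sin θ) : ℝ × ℝ) = cos θ • ((1 : ℝ), (0 : ℝ)) + sin θ • ((0 : ℝ), (1 : ℝ)) := by
        ext <;> simp
      rw [this, map_add, map_smul, map_smul, smul_eq_mul, smul_eq_mul]
    rw [← hlin]
    convert h using 1 <;> rfl
  have hg1 : ∀ θ, ContDiff ℝ 1 (g θ) := fun θ ↦
    hψ.comp ((contDiff_id.mul contDiff_const).prodMk (contDiff_id.mul contDiff_const))
  have hgs : ∀ θ, HasCompactSupport (g θ) := by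
    intro θ
    refine HasCompactSupport.intro (isCompact_Icc (a := -R) (b := R)) fun r hr ↦ ?_
    apply hzero'
    have hr' : R ^ 2 ≤ r ^ 2 := by
      rcases not_and_or.1 (fun h ↦ hr ⟨h.1, h.2⟩) with h | h
      · push Not at h
        nlinarith
      · push Not at h
        nlinarith
    have : (r * cos θ) ^ 2 + (r * sin θ) ^ 2 = r ^ 2 := by
      nlinarith [sin_sq_add_cos_sq θ]
    simpa [this] using hr'
  -- the integrand in polar coordinates is the radial derivative
  set f : ℝ × ℝ → ℝ := fun q ↦ (q.1 * fderiv ℝ ψ q (1, 0) + q.2 * fderiv ℝ ψ q (0, 1)) /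
    (q.1 ^ 2 + q.2 ^ 2) with hf
  set F : ℝ × ℝ → ℝ := fun p ↦ D p.2 p.1 with hF
  have hpolar : ∀ p ∈ polarCoord.target, p.1 • f (polarCoord.symm p) = F p := by
    rintro ⟨r, θ⟩ ⟨hr, -⟩
    simp only [mem_Ioi] at hr
    simp only [hf, hF, hD, polarCoord_symm_apply, smul_eq_mul]
    have hr2 : (r * cos θ) ^ 2 + (r * sin θ) ^ 2 = r ^ 2 := by nlinarith [sin_sq_add_cos_sq θ]
    rw [hr2]
    field_simp
  -- continuity and integrability of `F` on the target
  have hFc : Continuous F := by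
    have hc1 : Continuous fun p : ℝ × ℝ ↦ ((p.1 * cos p.2, p.1 * sin p.2) : ℝ × ℝ) :=
      (continuous_fst.mul (continuous_cos.comp continuous_snd)).prodMk
        (continuous_fst.mul (continuous_sin.comp continuous_snd))
    have hfd : Continuous (fderiv ℝ ψ) := hψ.continuous_fderiv one_ne_zero
    have hev : ∀ v : ℝ × ℝ, Continuous fun p : ℝ × ℝ ↦ fderiv ℝ ψ (p.1 * cos p.2, p.1 * sin p.2) v :=
      fun v ↦ (hfd.comp hc1).clm_apply continuous_const
    simp only [hF, hD]
    exact ((continuous_cos.comp continuous_snd).mul (hev _)).add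
      ((continuous_sin.comp continuous_snd).mul (hev _))
  have hF0 : ∀ p : ℝ × ℝ, R ≤ p.1 → F p = 0 := by
    rintro ⟨r, θ⟩ hr
    simp only at hr
    have hr2 : R ^ 2 ≤ (r * cos θ) ^ 2 + (r * sin θ) ^ 2 := by
      have : (r * cos θ) ^ 2 + (r * sin θ) ^ 2 = r ^ 2 := by nlinarith [sin_sq_add_cos_sq θ]
      rw [this]
      exact pow_le_pow_left₀ hRpos.le hr 2
    simp only [hF, hD, hzero (r * cos θ, r * sin θ) hr2, _root_.zero_apply, mul_zero, add_zero]
  have hFint : IntegrableOn F (Ioi (0 : ℝ) ×ˢ Ioo (-π) π) := by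
    have h1 : IntegrableOn F (Icc (0 : ℝ) R ×ˢ Icc (-π) π) :=
      hFc.continuousOn.integrableOn_compact (isCompact_Icc.prod isCompact_Icc)
    have h2 : IntegrableOn F (Ici R ×ˢ (univ : Set ℝ)) :=
      IntegrableOn.congr_fun integrableOn_zero (fun p hp ↦ (hF0 p hp.1).symm)
        (measurableSet_Ici.prod MeasurableSet.univ)
    refine (h1.union h2).mono_set ?_
    rintro ⟨r, θ⟩ ⟨hr, hθ⟩
    simp only [mem_Ioi] at hr
    by_cases hrR : r ≤ R
    · exact Or.inl ⟨⟨hr.le, hrR⟩, Ioo_subset_Icc_self hθ⟩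
    · exact Or.inr ⟨(not_le.1 hrR).le, mem_univ _⟩
  -- the computation
  have hinner : ∀ θ, ∫ r in Ioi (0 : ℝ), F (r, θ) = -ψ 0 := by
    intro θ
    have hde : deriv (g θ) = fun r ↦ D θ r := funext fun r ↦ (hderiv θ r).deriv
    have h := (hgs θ).integral_Ioi_deriv_eq (hg1 θ) 0
    rw [hde] at h
    simp only [hF]
    rw [h]
    simp only [hg, zero_mul, neg_inj]
    rfl
  calc ∫ q, f q = ∫ p in polarCoord.target, p.1 • f (polarCoord.symm p) :=
        (integral_comp_polarCoord_symm f).symm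
    _ = ∫ p in polarCoord.target, F p :=
        setIntegral_congr_fun polarCoord.open_target.measurableSet hpolar
    _ = ∫ p in Ioi (0 : ℝ) ×ˢ Ioo (-π) π, F p := rfl
    _ = ∫ θ in Ioo (-π) π, ∫ r in Ioi (0 : ℝ), F (r, θ) := by
        have hμ : (volume : Measure (ℝ × ℝ)).restrict (Ioi (0 : ℝ) ×ˢ Ioo (-π) π) =
            ((volume : Measure ℝ).restrict (Ioi 0)).prod ((volume : Measure ℝ).restrict (Ioo (-π) π)) :=
          (Measure.prod_restrict _ _).symm
        have hint : Integrable F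
            (((volume : Measure ℝ).restrict (Ioi 0)).prod ((volume : Measure ℝ).restrict (Ioo (-π) π))) := by
          rw [← hμ]; exact hFint
        rw [hμ]
        exact integral_prod_symm F hint
    _ = ∫ θ in Ioo (-π) π, -ψ 0 := setIntegral_congr_fun measurableSet_Ioo fun θ _ ↦ hinner θ
    _ = -(2 * π * ψ 0) := by
        rw [setIntegral_const, measureReal_def, Real.volume_Ioo, smul_eq_mul,
          ENNReal.toReal_ofReal (by linarith [pi_pos])]
        ring

/-- **`∫ (z·∇Ψ)/|z|² dz = −2π Ψ(0)` on `EuclideanSpace ℝ (Fin 2)`** for `Ψ ∈ C¹_c`: the planar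
statement `integral_radialDeriv_div_normSq` transported along the volume-preserving linear
isometry `ℝ² ≃ ℝ × ℝ`. [cite: Chern1944, §2] -/
theorem integral_radialDeriv_div_normSq_euclidean {Ψ : EuclideanSpace ℝ (Fin 2) → ℝ}
    (hΨ : ContDiff ℝ 1 Ψ) (hs : HasCompactSupport Ψ) :
    ∫ z : EuclideanSpace ℝ (Fin 2),
        (∑ i, z i * fderiv ℝ Ψ z (EuclideanSpace.single i 1)) / ‖z‖ ^ 2 = -(2 * π * Ψ 0) := by
  -- the measurable and the continuous linear identifications `ℝ² ≃ ℝ × ℝ`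
  set T : EuclideanSpace ℝ (Fin 2) ≃ᵐ ℝ × ℝ :=
    (MeasurableEquiv.toLp 2 (Fin 2 → ℝ)).symm.trans MeasurableEquiv.finTwoArrow with hT
  have hTmp : MeasurePreserving T volume volume :=
    (EuclideanSpace.volume_preserving_symm_measurableEquiv_toLp (Fin 2)).trans
      (volume_preserving_finTwoArrow ℝ)
  set Lc : ℝ × ℝ →L[ℝ] EuclideanSpace ℝ (Fin 2) :=
    ((PiLp.continuousLinearEquiv 2 ℝ (fun _ : Fin 2 ↦ ℝ)).symm : (Fin 2 → ℝ) →L[ℝ] _).comp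
      ((ContinuousLinearEquiv.finTwoArrow ℝ ℝ).symm : ℝ × ℝ →L[ℝ] (Fin 2 → ℝ)) with hLc
  have hLc_apply : ∀ q : ℝ × ℝ, Lc q = WithLp.toLp 2 ![q.1, q.2] := fun q ↦ rfl
  have hTL : ∀ q : ℝ × ℝ, T.symm q = Lc q := by
    intro q
    rw [hLc_apply]
    rfl
  have hL0 : ∀ q : ℝ × ℝ, Lc q 0 = q.1 := fun q ↦ by rw [hLc_apply]; rfl
  have hL1 : ∀ q : ℝ × ℝ, Lc q 1 = q.2 := fun q ↦ by rw [hLc_apply]; rfl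
  have hLe0 : Lc (1, 0) = EuclideanSpace.single 0 1 := by
    ext i
    fin_cases i <;> simp [hLc_apply]
  have hLe1 : Lc (0, 1) = EuclideanSpace.single 1 1 := by
    ext i
    fin_cases i <;> simp [hLc_apply]
  -- the planar function `ψ = Ψ ∘ Lc`
  set ψ : ℝ × ℝ → ℝ := Ψ ∘ Lc with hψ
  have hψ1 : ContDiff ℝ 1 ψ := hΨ.comp Lc.contDiff
  have hψs : HasCompactSupport ψ := by
    have hLh : Topology.IsClosedEmbedding Lc := by
      have : (Lc : ℝ × ℝ → EuclideanSpace ℝ (Fin 2)) =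
          ((PiLp.continuousLinearEquiv 2 ℝ (fun _ : Fin 2 ↦ ℝ)).symm.toHomeomorph ∘
            (ContinuousLinearEquiv.finTwoArrow ℝ ℝ).symm.toHomeomorph) := rfl
      rw [this]
      exact (Homeomorph.isClosedEmbedding _).comp (Homeomorph.isClosedEmbedding _)
    exact hs.comp_isClosedEmbedding hLh
  have hfd : ∀ q v, fderiv ℝ ψ q v = fderiv ℝ Ψ (Lc q) (Lc v) := by
    intro q v
    have h := ((hΨ.differentiable one_ne_zero) (Lc q)).hasFDerivAt.comp q Lc.hasFDerivAt
    rw [show ψ = Ψ ∘ Lc from rfl, h.fderiv, ContinuousLinearMap.comp_apply]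
  -- transport the integral
  have hint : ∫ z : EuclideanSpace ℝ (Fin 2),
      (∑ i, z i * fderiv ℝ Ψ z (EuclideanSpace.single i 1)) / ‖z‖ ^ 2 =
      ∫ q : ℝ × ℝ, (q.1 * fderiv ℝ ψ q (1, 0) + q.2 * fderiv ℝ ψ q (0, 1)) / (q.1 ^ 2 + q.2 ^ 2) := by
    rw [← hTmp.symm.integral_comp' ]
    refine integral_congr_ae (Eventually.of_forall fun q ↦ ?_)
    simp only
    rw [hTL q, EuclideanSpace.real_norm_sq_eq, Fin.sum_univ_two, Fin.sum_univ_two, hL0, hL1,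
      hfd, hfd, hLe0, hLe1]
  rw [hint, integral_radialDeriv_div_normSq hψ1 hψs]
  simp [hψ]

end Literature.Analysis.Calculus

end
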